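import Mathlib
import HarnessLib
import Summits.ResolutionOfSingularities.ResolutionOfSingularities.Theorems.WildQuotientsWildQuotientResolutionS1aLogExitFramesLocKato
import Literature.AlgebraicGeometry.Resolution.KiralyLutkebohmertCriterionProofs
import Literature.AlgebraicGeometry.Resolution.AffineDomainDimension

/-!
# Line L exit — part 5/5: `dim A₀ = dim A`, the cone chart, and the PROOF of `F1Loc` / `F1LocExit`

[OURS · L1 W4.5c · idea-1 g10/g11; plan-1 RULING (F1)/(γ′) SHAPE v1 2026-08-27T20:12:52Z; memos
`L/res-L1-w45c-idea-1/f1/F1-SHAPE.md` … `F1-SHAPE-v4.md`] — NOT statements of the manuscript; counted 0;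
AI-written and AI-reviewed only (weaker than expert review). Crux stmt-ResolutionOfSingularities-17941
(`WildQuotients.CyclicQuotientFourfolds`), skeleton line `s1a-logminvertex`, stubs `stub_localGame` (EXIT half:
the `S1.LogExitZone` clause of `S1.KillOrExitModel`) / `stub_logExitPatching`. This is PART 5/5 of the helper
module v3 (single-file form `f1/S1aLogExitFrames.lean` sha16 44731ecda72d117c, 1518 lines, split along its §
boundaries for the gate's per-file size cap; declarations byte-identical, one namespace
`…Theorems.WildQuotientResolution.S1.LogExitFrames` across the parts). No `sorry`, no `instance`, no `notation`;
Literature notions (`augmentationIdeal`, `invariantSubring`, `LogChart.*`, `Scheme.IsLogRegular`) are CITED, not restated.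

* §10 (REAL) `ringKrullDim_degZeroInvariants`: `x^{|ι|} ∈ A₀` for a homogeneous invariant `x`, so `A = B^σ` is
  integral over `A₀ = B₀^σ` and `dim A₀ = dim A` (`Literature…ringKrullDim_eq_of_isIntegral`).
* §11 (REAL) `coneChart : Multiplicative (charCone χ) →* degZeroInvariants 𝒜 σ`, `m ↦ s^m`; `nonunitIdeal_coneChart`
  (Kato ideal `= 𝔪_{A₀}`), `unitFace_coneChart` (`= {0}`); **`theorem f1Loc (p) : F1Loc p`** (Király–Lütkebohmert
  `KiralyLutkebohmertRegularity_holds` ⇒ `A` regular; parts 4 + the above ⇒ `A₀ ⧸ I` a field, `dim A₀ = d`: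
  `LogChart.IsLogRegularLocal`) and **`theorem f1LocExit (p) : F1LocExit p := f1LocExit_of_f1Loc p (f1Loc p)`**.
  Axioms of both: `propext`, `Classical.choice`, `Quot.sound`. The (I-T) binder `IsUnit (|ι| : B)` of `F1Loc` is not
  used by the proof (kept for the consumer's bookkeeping). Elementary and characteristic-free: no Cohen structure
  theorem, no completeness.
-/

set_option linter.dupNamespace false

noncomputable section

open CategoryTheory AlgebraicGeometry TopologicalSpace
open Literature.AlgebraicGeometry.Resolution

namespace Summit.ResolutionOfSingularities.ResolutionOfSingularities.Theorems.WildQuotientResolution.S1.LogExitFrames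

/-! ## §10 Toward `F1Loc`: `A = B^σ` is integral over `A₀ = B₀^σ`, so `dim A₀ = dim A` (REAL, v3) -/

section Dimension

open DirectSum IsLocalRing

variable {ι : Type*} [DecidableEq ι] [AddCommGroup ι] [Fintype ι] {B : Type*} [CommRing B]
  (𝒜 : ι → AddSubgroup B) [GradedRing 𝒜] (σ : B ≃+* B)

omit [Fintype ι] in
/-- `degZeroInvariants 𝒜 σ` is a subring of the invariant subring `B^σ`. -/
theorem degZeroInvariants_le_invariantSubring : degZeroInvariants 𝒜 σ ≤ invariantSubring σ :=
  inf_le_right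

/-- **`dim A₀ = dim A`.** For a finite grading group, every homogeneous `σ`-invariant `x` has
`x ^ |ι| ∈ A₀`, so `A = B^σ` is integral over `A₀ = B₀^σ` and Krull dimension is preserved
(`Literature…ringKrullDim_eq_of_isIntegral`, Matsumura Thm. 9.4). [OURS · L1 W4.5c] -/
theorem ringKrullDim_degZeroInvariants (hσ : ∀ c : ι, ∀ b ∈ 𝒜 c, σ b ∈ 𝒜 c) :
    ringKrullDim (degZeroInvariants 𝒜 σ) = ringKrullDim (invariantSubring σ) := by
  classical
  letI alg : Algebra (degZeroInvariants 𝒜 σ) (invariantSubring σ) :=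
    (Subring.inclusion (degZeroInvariants_le_invariantSubring 𝒜 σ)).toAlgebra
  have halg : ∀ y : degZeroInvariants 𝒜 σ,
      algebraMap (degZeroInvariants 𝒜 σ) (invariantSubring σ) y =
        Subring.inclusion (degZeroInvariants_le_invariantSubring 𝒜 σ) y := fun _ => rfl
  haveI : Algebra.IsIntegral (degZeroInvariants 𝒜 σ) (invariantSubring σ) := by
    refine ⟨fun x => ?_⟩
    have hcomp : ∀ c, ((decompose 𝒜 (x : B)) c : B) ∈ invariantSubring σ :=
      fun c => coe_decompose_mem_invariantSubring 𝒜 σ hσ x.2 c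
    have hx : x = ∑ c ∈ (decompose 𝒜 (x : B)).support, (⟨_, hcomp c⟩ : invariantSubring σ) := by
      apply Subtype.ext
      rw [AddSubmonoidClass.coe_finsetSum]
      exact (sum_support_decompose 𝒜 _).symm
    rw [hx]
    refine IsIntegral.sum _ fun c _ => ?_
    refine IsIntegral.of_pow (Fintype.card_pos (α := ι)) ?_
    have hN0 : ((decompose 𝒜 (x : B)) c : B) ^ Fintype.card ι ∈ 𝒜 0 := by
      have := SetLike.pow_mem_graded (Fintype.card ι) ((decompose 𝒜 (x : B)) c).2
      rwa [card_nsmul_eq_zero] at this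
    have hNA : ((decompose 𝒜 (x : B)) c : B) ^ Fintype.card ι ∈ invariantSubring σ :=
      Subring.pow_mem _ (hcomp c) _
    have heq : (⟨_, hcomp c⟩ : invariantSubring σ) ^ Fintype.card ι =
        algebraMap (degZeroInvariants 𝒜 σ) (invariantSubring σ) ⟨_, hN0, hNA⟩ := by
      rw [halg]
      apply Subtype.ext
      simp only [SubmonoidClass.coe_pow, Subring.coe_inclusion]
    rw [heq]
    exact isIntegral_algebraMap
  have hinj : Function.Injective (algebraMap (degZeroInvariants 𝒜 σ) (invariantSubring σ)) := by
    intro a b hab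
    rw [halg, halg] at hab
    apply Subtype.ext
    simpa [Subring.coe_inclusion] using congr_arg Subtype.val hab
  exact (ringKrullDim_eq_of_isIntegral (R := degZeroInvariants 𝒜 σ)
    (S := invariantSubring σ) hinj).symm

end Dimension

/-! ## §11 `F1Loc p` holds (REAL, v3): the cone chart and the assembly -/

section ConeChart

open DirectSum IsLocalRing

variable {ι : Type} [DecidableEq ι] [AddCommGroup ι] [Fintype ι] {B : Type} [CommRing B]
  (𝒜 : ι → AddSubgroup B) [GradedRing 𝒜] (σ : B ≃+* B)

omit [DecidableEq ι] [Fintype ι] in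
/-- For a non-negative integer vector `m`, `∑ (m i).toNat • χ i` is the `ℤ`-combination `∑ m i • χ i`. -/
theorem sum_toNat_smul_eq {d : ℕ} (χ : Fin d → ι) (m : Fin d → ℤ) (hm : ∀ i, 0 ≤ m i) :
    ∑ i, (m i).toNat • χ i = ∑ i, m i • χ i :=
  Finset.sum_congr rfl fun i _ => by rw [← natCast_zsmul, Int.toNat_of_nonneg (hm i)]

variable {d : ℕ} (s : Fin d → invariantSubring σ) (χ : Fin d → ι)

omit [Fintype ι] in
/-- The cone monomial `∏ s i ^ (m i).toNat` of a character-cone vector `m` is a degree-zero invariant. -/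
theorem coneMonomial_mem (hs : ∀ i, ((s i : invariantSubring σ) : B) ∈ 𝒜 (χ i)) (m : charCone χ) :
    ∏ i, ((s i : invariantSubring σ) : B) ^ ((m : Fin d → ℤ) i).toNat ∈ degZeroInvariants 𝒜 σ := by
  refine ⟨?_, prod_pow_mem_invariantSubring σ s _⟩
  have h := prod_pow_mem_graded_of 𝒜 σ s χ hs fun i => ((m : Fin d → ℤ) i).toNat
  rw [sum_toNat_smul_eq χ _ m.2.1, m.2.2] at h
  exact h

/-- The **cone chart** `m ↦ ∏ (s i)^(m i)` on the character cone `P_χ`, valued in `A₀ = B₀^σ`.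
[OURS · L1 W4.5c] -/
def coneChart (hs : ∀ i, ((s i : invariantSubring σ) : B) ∈ 𝒜 (χ i)) :
    Multiplicative (charCone χ) →* degZeroInvariants 𝒜 σ where
  toFun x := ⟨∏ i, ((s i : invariantSubring σ) : B) ^
      (((Multiplicative.toAdd x : charCone χ) : Fin d → ℤ) i).toNat,
    coneMonomial_mem 𝒜 σ s χ hs (Multiplicative.toAdd x)⟩
  map_one' := by
    apply Subtype.ext
    simp
  map_mul' x y := by
    apply Subtype.ext
    show ∏ i, ((s i : invariantSubring σ) : B) ^
        (((Multiplicative.toAdd (x * y) : charCone χ) : Fin d → ℤ) i).toNat =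
      (∏ i, ((s i : invariantSubring σ) : B) ^
          (((Multiplicative.toAdd x : charCone χ) : Fin d → ℤ) i).toNat) *
        ∏ i, ((s i : invariantSubring σ) : B) ^
          (((Multiplicative.toAdd y : charCone χ) : Fin d → ℤ) i).toNat
    rw [← Finset.prod_mul_distrib]
    refine Finset.prod_congr rfl fun i _ => ?_
    rw [← pow_add, toAdd_mul, AddSubmonoid.coe_add, Pi.add_apply,
      Int.toNat_add ((Multiplicative.toAdd x : charCone χ).2.1 i)
        ((Multiplicative.toAdd y : charCone χ).2.1 i)]

omit [Fintype ι] in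
/-- The value of the cone chart on `ofAdd m` is the cone monomial `∏ s i ^ (m i).toNat`. -/
@[simp] theorem coe_coneChart_ofAdd (hs : ∀ i, ((s i : invariantSubring σ) : B) ∈ 𝒜 (χ i))
    (m : charCone χ) :
    ((coneChart 𝒜 σ s χ hs (Multiplicative.ofAdd m) : degZeroInvariants 𝒜 σ) : B) =
      ∏ i, ((s i : invariantSubring σ) : B) ^ ((m : Fin d → ℤ) i).toNat :=
  rfl

omit [Fintype ι] in
/-- Cone monomials are values of the cone chart at non-zero cone elements. -/
theorem coneMonomials_subset_image [IsLocalRing B] [IsLocalRing (invariantSubring σ)]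
    [IsLocalRing (degZeroInvariants 𝒜 σ)]
    (hσ : ∀ c : ι, ∀ b ∈ 𝒜 c, σ b ∈ 𝒜 c)
    (hs : ∀ i, ((s i : invariantSubring σ) : B) ∈ 𝒜 (χ i))
    (hspan : Ideal.span (Set.range s) = maximalIdeal (invariantSubring σ)) :
    coneMonomials 𝒜 σ s χ ⊆ (fun q : charCone χ => coneChart 𝒜 σ s χ hs (Multiplicative.ofAdd q)) ''
      {q | ¬ IsUnit (coneChart 𝒜 σ s χ hs (Multiplicative.ofAdd q))} := by
  rintro y hy
  obtain ⟨m, hm0, hmχ, hym⟩ := hy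
  have hmem : (fun i => (m i : ℤ)) ∈ charCone χ := by
    refine ⟨fun i => Int.natCast_nonneg (m i), ?_⟩
    simpa [natCast_zsmul] using hmχ
  have hval : coneChart 𝒜 σ s χ hs (Multiplicative.ofAdd ⟨_, hmem⟩) = y := by
    apply Subtype.ext
    rw [coe_coneChart_ofAdd, hym]
    simp
  refine ⟨⟨_, hmem⟩, ?_, hval⟩
  show ¬ IsUnit (coneChart 𝒜 σ s χ hs (Multiplicative.ofAdd ⟨_, hmem⟩))
  rw [hval]
  have hy𝔪 : y ∈ maximalIdeal (degZeroInvariants 𝒜 σ) :=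
    span_coneMonomials_le_maximalIdeal 𝒜 σ s χ hσ hspan (Ideal.subset_span ⟨m, hm0, hmχ, hym⟩)
  exact (mem_maximalIdeal _).1 hy𝔪

/-- **Kato's ideal of the cone chart is `𝔪_{A₀}`.** [OURS · L1 W4.5c] -/
theorem nonunitIdeal_coneChart [IsLocalRing B] [IsLocalRing (invariantSubring σ)]
    [IsLocalRing (degZeroInvariants 𝒜 σ)]
    (hσ : ∀ c : ι, ∀ b ∈ 𝒜 c, σ b ∈ 𝒜 c)
    (hR : ∀ c : ι, c ≠ 0 → ∀ b ∈ 𝒜 c, b ∈ maximalIdeal B)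
    (hs : ∀ i, ((s i : invariantSubring σ) : B) ∈ 𝒜 (χ i))
    (hspan : Ideal.span (Set.range s) = maximalIdeal (invariantSubring σ)) :
    LogChart.nonunitIdeal (charCone χ) (coneChart 𝒜 σ s χ hs) =
      maximalIdeal (degZeroInvariants 𝒜 σ) := by
  apply le_antisymm (LogChart.nonunitIdeal_le_maximalIdeal _ _)
  calc maximalIdeal (degZeroInvariants 𝒜 σ)
      ≤ Ideal.span (coneMonomials 𝒜 σ s χ) :=
        maximalIdeal_degZeroInvariants_le_span 𝒜 σ s χ hσ hR hs hspan
    _ ≤ LogChart.nonunitIdeal (charCone χ) (coneChart 𝒜 σ s χ hs) :=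
        Ideal.span_mono (coneMonomials_subset_image 𝒜 σ s χ hσ hs hspan)

omit [Fintype ι] in
/-- **The unit face of the cone chart is `{0}`.** [OURS · L1 W4.5c] -/
theorem unitFace_coneChart [IsLocalRing B] [IsLocalRing (invariantSubring σ)]
    [IsLocalRing (degZeroInvariants 𝒜 σ)]
    (hσ : ∀ c : ι, ∀ b ∈ 𝒜 c, σ b ∈ 𝒜 c)
    (hs : ∀ i, ((s i : invariantSubring σ) : B) ∈ 𝒜 (χ i))
    (hspan : Ideal.span (Set.range s) = maximalIdeal (invariantSubring σ)) :
    LogChart.unitFace (charCone χ) (coneChart 𝒜 σ s χ hs) = {0} := by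
  ext q
  rw [LogChart.mem_unitFace_iff, Set.mem_singleton_iff]
  constructor
  · intro hu
    by_contra hq
    -- `q ≠ 0`: its monomial is a cone monomial, hence in `𝔪_{A₀}`, not a unit
    have hq' : (fun i => ((q : Fin d → ℤ) i).toNat) ≠ 0 := by
      intro h0
      apply hq
      apply Subtype.ext
      funext i
      have h1 := congr_fun h0 i
      have h2 := q.2.1 i
      simp only [Pi.zero_apply, Int.toNat_eq_zero] at h1
      show (q : Fin d → ℤ) i = 0
      omega
    have hmem : coneChart 𝒜 σ s χ hs (Multiplicative.ofAdd q) ∈ coneMonomials 𝒜 σ s χ := by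
      refine ⟨fun i => ((q : Fin d → ℤ) i).toNat, hq', ?_, rfl⟩
      rw [sum_toNat_smul_eq χ _ q.2.1]
      exact q.2.2
    have h𝔪 := span_coneMonomials_le_maximalIdeal 𝒜 σ s χ hσ hspan (Ideal.subset_span hmem)
    exact (mem_maximalIdeal _).1 h𝔪 hu
  · rintro rfl
    rw [ofAdd_zero, map_one]
    exact isUnit_one

end ConeChart

section Assembly

open DirectSum IsLocalRing

/-- **`F1Loc p` HOLDS** (the LOCAL FRAME LEMMA at a KILL point, ring level; typed in §5 on tri-1's
signature with the inertia hypothesis (R-triv)).  Proof = §7–§11: Király–Lütkebohmert regularity of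
`A = B^σ` (`KiralyLutkebohmertRegularity_holds`) ▸ homogeneous regular system of parameters `s, χ`
(§8, graded Nakayama under (R-triv)) ▸ the cone chart `P_χ → A₀ = B₀^σ`, `m ↦ s^m` (§11) has Kato
ideal `𝔪_{A₀}` (§9) and unit face `{0}`, and `dim A₀ = dim A = d` (§10, integrality), so
`A₀/I = κ` is regular of dimension `0 = dim A₀ − (d − 0)`: the chart is log regular at the closed
point. [OURS · L1 W4.5c] -/
theorem f1Loc (p : ℕ) : F1Loc p := by
  intro hp ι _ _ _ B _ _ 𝒜 _ σ _ hR hσ hord hne hkill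
  classical
  haveI hA : IsRegularLocalRing (invariantSubring σ) :=
    (KiralyLutkebohmertRegularity_holds B p σ hp hord hne hkill).1
  obtain ⟨s, χ, hs, hspan⟩ := exists_homogeneous_generators 𝒜 σ hσ hR
  haveI hA₀ : IsLocalRing (degZeroInvariants 𝒜 σ) := isLocalRing_degZeroInvariants 𝒜 σ hσ
  have hdimA : ringKrullDim (invariantSubring σ) =
      ((maximalIdeal (invariantSubring σ)).spanFinrank : ℕ) :=
    (IsRegularLocalRing.spanFinrank_maximalIdeal (R := invariantSubring σ)).symm
  refine ⟨(maximalIdeal (invariantSubring σ)).spanFinrank, inferInstance, s, χ, hs, hdimA, hspan,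
    hA₀, coneChart 𝒜 σ s χ hs, fun m => rfl, ?_⟩
  have hI := nonunitIdeal_coneChart 𝒜 σ s χ hσ hR hs hspan
  have hF := unitFace_coneChart 𝒜 σ s χ hσ hs hspan
  rw [LogChart.IsLogRegularLocal, hI, hF]
  have hfield : IsField (degZeroInvariants 𝒜 σ ⧸ maximalIdeal (degZeroInvariants 𝒜 σ)) :=
    (Ideal.Quotient.maximal_ideal_iff_isField_quotient _).mp inferInstance
  refine ⟨?_, ?_⟩
  · letI := Ideal.Quotient.field (maximalIdeal (degZeroInvariants 𝒜 σ))
    infer_instance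
  · rw [ringKrullDim_eq_zero_of_isField hfield, zero_add, ringKrullDim_degZeroInvariants 𝒜 σ hσ,
      hdimA]
    congr 1
    have h0 : Submodule.span ℤ ((fun q : charCone χ =>
        (q : Fin (maximalIdeal (invariantSubring σ)).spanFinrank → ℤ)) ''
          ({0} : Set (charCone χ))) = ⊥ := by
      rw [Set.image_singleton, ZeroMemClass.coe_zero, Submodule.span_zero_singleton]
    rw [h0, finrank_bot, Nat.sub_zero]

/-- **`F1LocExit p` HOLDS**: the exit chart in the `LogExitZone`/`LogAtlas` shape (§6 ∘ `f1Loc`).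
[OURS · L1 W4.5c] -/
theorem f1LocExit (p : ℕ) : F1LocExit p :=
  f1LocExit_of_f1Loc p (f1Loc p)

end Assembly

end Summit.ResolutionOfSingularities.ResolutionOfSingularities.Theorems.WildQuotientResolution.S1.LogExitFrames
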